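import Summits.AtomisticToContinuum.Crystallization.Theorems.FrustratedLawDichotomyCollarCensusMilliDoorFree

/-!
# FrustratedLawDichotomy · cruxes `AperiodicFrustratedLawGap` / `PeriodicFrustratedLawGap` (stmt-AtomisticToContinuum-27623 / 27624) — the collared
# leaf line for a GENERIC motif exemption `ExM`, and the UNION-OVER-STEPS exemption (decomp-a2c, prover hand 2, generation 18; critic row 627
# «union exemption», lens-5 g41 NODE «QuietCollar» §2 optional strengthening; structural share: reduce to the most general landed lemma, then specialise)

The collared nodes of record (`…CollarCensusKappa.aperiodicFrustratedLawGap_of_collarMotifCapKK`, `…CollarCensusGeneric.…_generic`,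
`…CollarCensusQuiet.…KKS`) fix the motif-level exemption to `CollarCore r eUp ε Rm s t = Collar r (NonEquilibriumCore eUp ε Rm s t)` at ONE step `s`.
The two bridges they are built from are generic: `…CollarCensusKappa.schurTopologicalPricingX_of_collarMotifCapK` takes ANY motif exemption `ExM`
whose flag is `ρ₁`-local and which implies the cluster-level exemption `Ex` on separated clusters, and `…ExemptSplit.aperiodicFrustratedLawGap_of_splitX`
takes ANY deep-absent `Ex`.  This file composes them once (§1: the APEX node, generic in the range data, both levies, `ExM` and `Ex`), records that
the census object and its three pieces are ANTITONE in `ExM` (§2: a larger exempt class gives WEAKER pieces), and instantiates the apex at the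
UNION OF THE COLLAR EXEMPTIONS OVER EVERY STEP `0 ≤ s ≤ S` (§3–§4, written as a `fun`-term, no new definition):
`ExM∪(S) N y j :⟺ ∃ s, 0 ≤ s ∧ s ≤ S ∧ NonEquilibriumCore eUp ε Rm s t N y j` — a site is exempt as soon as a one-atom move of ANY length
`< 7/10` (step budget `s ≤ S`, allowance `ε + σ(s)` with `σ` increasing, so the best `s` is the move length itself) or the removal test fires within `Rm`.
Since `NonEquilibriumCore … s … ⊆ ExM∪(S)` for every `s ∈ [0, S]`, the three pieces at `Collar (9/2) ExM∪(3/2)` are implied by the pieces at the milli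
step `1/20` AND by the pieces at the quiet step `1/200` (§4 `collarPiecesKK_union_of_step`): every certificate for either line transfers by name, and
the union line `aperiodicFrustratedLawGap_of_collarPiecesKK_milli_union(_doorFree)` is the weakest T-side leaf of the step family at zero cost
(`D_T = Mball (9/2)·C_T⁴⁵(9/5)` unchanged).  All `[folklore]` bookkeeping / chaining; 0 sorry; no definitions.
-/

noncomputable section

namespace Summit.AtomisticToContinuum.Crystallization.Theorems.FrustratedLawDichotomyCollarCensusUnion

open scoped BigOperators Classical
open Summit.AtomisticToContinuum.Crystallization.Theorems.ChargedEnergyGapNegative (E3 eStar)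
open Summit.AtomisticToContinuum.Crystallization.Theorems.FrustratedLawDichotomyRangeCut
open Summit.AtomisticToContinuum.Crystallization.Theorems.FrustratedLawDichotomySchurCut
open Summit.AtomisticToContinuum.Crystallization.Theorems.FrustratedLawDichotomyRuleToolkit (IsLocalFeature)
open Summit.AtomisticToContinuum.Crystallization.Theorems.FrustratedLawDichotomyAveragingCut
  (ball ballAvg mem_ball Mball one_le_Mball Dfl Dfl_pos CT₀ Dfl_le_CT₀ CT₄₅ W₄₅_cutBounds CutBounds)
open Summit.AtomisticToContinuum.Crystallization.Theorems.FrustratedLawDichotomyAveragingRule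
open Summit.AtomisticToContinuum.Crystallization.Theorems.FrustratedLawDichotomyAveragingRuleCap
open Summit.AtomisticToContinuum.Crystallization.Theorems.FrustratedLawDichotomyAveragingRuleTightFree (TightNearCap BadNearCap)
open Summit.AtomisticToContinuum.Crystallization.Theorems.FrustratedLawDichotomyExemptDoor (SitePred DeepAbsent)
open Summit.AtomisticToContinuum.Crystallization.Theorems.FrustratedLawDichotomyExemptLocOpt (LocOptFails deepAbsent_locOptFails)
open Summit.AtomisticToContinuum.Crystallization.Theorems.FrustratedLawDichotomyExemptSplit
  (SchurTopologicalPricingX SchurElasticPricingX aperiodicFrustratedLawGap_of_splitX periodicFrustratedLawGap_of_splitX)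
open Summit.AtomisticToContinuum.Crystallization.Theorems.FrustratedLawDichotomyBumpAutocorrelation (sf₄₅_holds)
open Summit.AtomisticToContinuum.Crystallization.Theorems.FrustratedLawDichotomyExemptAbsorption
open Summit.AtomisticToContinuum.Crystallization.Theorems.FrustratedLawDichotomyExemptAbsorptionRecord
open Summit.AtomisticToContinuum.Crystallization.Theorems.FrustratedLawDichotomyCollarCensus
open Summit.AtomisticToContinuum.Crystallization.Theorems.FrustratedLawDichotomyCollarCensusKappa
open Summit.AtomisticToContinuum.Crystallization.Theorems.FrustratedLawDichotomyCollarCensusMilli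
open Summit.AtomisticToContinuum.Crystallization.Theorems.FrustratedLawDichotomyCollarCensusQuiet
open Summit.AtomisticToContinuum.Crystallization.Theorems.GrainCoreNetworkSplitMuEquilibriumDoor (muEquilibriumDoor)

/-! ## §1. The apex: generic range data, both levies, generic motif exemption `ExM`, generic deep-absent cluster exemption `Ex` -/

/-- ★★★ **THE COLLARED NODE, GENERIC IN EVERYTHING THE LANDED BRIDGES ALLOW** (`…Kappa.schurTopologicalPricingX_of_collarMotifCapK` ∘
`…ExemptSplit.aperiodicFrustratedLawGap_of_splitX`).  Range data: Schur-admissible split `(w, ω, A)` (`SchurFloor w ω A`), `W = effPot w ω A` with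
`CutBounds W R B` and `W = 0` on `[R′, ∞)`, ceiling `UP(eUp)`; levies `0 < κ_T ≤ 1`, `0 < κ_E`; a cluster-level exemption `Ex`, deep-absent at some
depth `M`, shared by the E-side hypothesis `Eopt-raw(κ_E; Ex)`; a motif-level exemption `ExM` whose flag is `ρ₁`-local and which implies `Ex` on injective
`7/10`-separated clusters; geometry `0 ≤ ρ ≤ ρ₁ + r`, `0 ≤ r`, `0 ≤ ρ₁`, `R′ ≤ ρ₁ + r`, `13/10·D + 1 ≤ ρ₁ + r`, `ρ + (ρ₁ + r) ≤ ϱ`.  Then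
`MuEquilibriumDoor ∧ EquilibriumMotifPricingCapK κ_T ρ ϱ D W (eUp + A) (Collar r ExM) ⟹ AperiodicFrustratedLawGap`. [folklore chaining] -/
theorem aperiodicFrustratedLawGap_of_collarMotifCapKK_exM {w ω : ℝ → ℝ} {A R B R' eUp κT κE ρ r ρ₁ ϱ D CE DE DX M : ℝ} {ExM Ex : SitePred}
    (hDoor : Summit.AtomisticToContinuum.Crystallization.Theses.GrainCoreNetworkSplit.MuEquilibriumDoor)
    (hF : SchurFloor w ω A) (hWB : CutBounds (effPot w ω A) R B) (hW : ∀ u, R' ≤ u → effPot w ω A u = 0)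
    (hU : PeriodicEnergyCeiling eUp) (hEx : DeepAbsent M Ex) (hDX : 0 ≤ DX) (hκE : 0 < κE)
    (hE : SchurElasticPricingX (1 / 20) (1 / 8) w ω A eUp κE CE DE DX Ex)
    (hκ0 : 0 < κT) (hκ1 : κT ≤ 1) (h0 : 0 ≤ ρ) (hr : 0 ≤ r) (h1 : 0 ≤ ρ₁) (hρ : ρ ≤ ρ₁ + r) (hR : R' ≤ ρ₁ + r)
    (hD : 13 / 10 * D + 1 ≤ ρ₁ + r) (hϱ : ρ + (ρ₁ + r) ≤ ϱ) (hExM : IsLocalFeature ρ₁ (flag ExM))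
    (hImp : ∀ (N : ℕ) (y : Fin N → E3), Function.Injective y → Sep y → ∀ j : Fin N, ExM N y j → Ex N y j)
    (h : EquilibriumMotifPricingCapK κT ρ ϱ D (effPot w ω A) (eUp + A) (Collar r ExM)) :
    Summit.AtomisticToContinuum.Crystallization.Theses.FrustratedLawDichotomy.AperiodicFrustratedLawGap :=
  have hC : 0 ≤ CT₀ R B (eUp + A) ρ :=
    (Dfl_pos hWB.range_nonneg hWB.floor_nonneg).le.trans (Dfl_le_CT₀ hWB.range_nonneg hWB.floor_nonneg ρ)
  have hM : 0 ≤ Mball r * CT₀ R B (eUp + A) ρ := mul_nonneg (zero_le_one.trans (one_le_Mball hr)) hC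
  aperiodicFrustratedLawGap_of_splitX hDoor (by norm_num) hF hU hEx hκ0 hM
    (schurTopologicalPricingX_of_collarMotifCapK hWB hW h0 hr h1 hρ hR hD hϱ hExM hκ0.le hκ1 hImp h) hκE hDX hE

/-- ★★ **The periodic sibling (27624) of the apex.** [folklore chaining] -/
theorem periodicFrustratedLawGap_of_collarMotifCapKK_exM {w ω : ℝ → ℝ} {A R B R' eUp κT κE ρ r ρ₁ ϱ D CE DE DX M : ℝ} {ExM Ex : SitePred}
    (hDoor : Summit.AtomisticToContinuum.Crystallization.Theses.GrainCoreNetworkSplit.MuEquilibriumDoor)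
    (hF : SchurFloor w ω A) (hWB : CutBounds (effPot w ω A) R B) (hW : ∀ u, R' ≤ u → effPot w ω A u = 0)
    (hU : PeriodicEnergyCeiling eUp) (hEx : DeepAbsent M Ex) (hDX : 0 ≤ DX) (hκE : 0 < κE)
    (hE : SchurElasticPricingX (1 / 20) (1 / 8) w ω A eUp κE CE DE DX Ex)
    (hκ0 : 0 < κT) (hκ1 : κT ≤ 1) (h0 : 0 ≤ ρ) (hr : 0 ≤ r) (h1 : 0 ≤ ρ₁) (hρ : ρ ≤ ρ₁ + r) (hR : R' ≤ ρ₁ + r)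
    (hD : 13 / 10 * D + 1 ≤ ρ₁ + r) (hϱ : ρ + (ρ₁ + r) ≤ ϱ) (hExM : IsLocalFeature ρ₁ (flag ExM))
    (hImp : ∀ (N : ℕ) (y : Fin N → E3), Function.Injective y → Sep y → ∀ j : Fin N, ExM N y j → Ex N y j)
    (h : EquilibriumMotifPricingCapK κT ρ ϱ D (effPot w ω A) (eUp + A) (Collar r ExM)) :
    Summit.AtomisticToContinuum.Crystallization.Theses.FrustratedLawDichotomy.PeriodicFrustratedLawGap :=
  have hC : 0 ≤ CT₀ R B (eUp + A) ρ :=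
    (Dfl_pos hWB.range_nonneg hWB.floor_nonneg).le.trans (Dfl_le_CT₀ hWB.range_nonneg hWB.floor_nonneg ρ)
  have hM : 0 ≤ Mball r * CT₀ R B (eUp + A) ρ := mul_nonneg (zero_le_one.trans (one_le_Mball hr)) hC
  periodicFrustratedLawGap_of_splitX hDoor (by norm_num) hF hU hEx hκ0 hM
    (schurTopologicalPricingX_of_collarMotifCapK hWB hW h0 hr h1 hρ hR hD hϱ hExM hκ0.le hκ1 hImp h) hκE hDX hE

/-- ★★ **The apex at the record range data** `(w₄₅, ω₄, 3/400; R′ = 9/2; eUp = −0.7175)` and the LOCAL-OPTIMALITY cluster exemption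
`Ex = LocOptFails e⋆ ε ϱ′ 1` (`ε > 0`), generic motif exemption `ExM`:
`MuEquilibriumDoor ∧ UP(−0.7175) ∧ Eopt-raw(κ_E; LocOptFails e⋆ ε ϱ′ 1) ∧ EquilibriumMotifPricingCapK κ_T ρ ϱ D W₄₅ e₄₅′ (Collar r ExM) ⟹ AperiodicFrustratedLawGap`
whenever `flag ExM` is `ρ₁`-local and `ExM ⟹ LocOptFails e⋆ ε ϱ′ 1` on injective separated clusters.  `…Kappa.…_of_collarMotifCapKK` is the instance
`ExM := NonEquilibriumCore (−0.7175) ε Rm s t`. [folklore chaining] -/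
theorem aperiodicFrustratedLawGap_of_collarMotifCapKK_exM_fourHalf {κT κE ρ r ρ₁ ϱ D ε ϱ' CE DE DX : ℝ} {ExM : SitePred}
    (hDoor : Summit.AtomisticToContinuum.Crystallization.Theses.GrainCoreNetworkSplit.MuEquilibriumDoor)
    (hU : PeriodicEnergyCeiling (-(7175 / 10000))) (hε : 0 < ε) (hDX : 0 ≤ DX) (hκE : 0 < κE)
    (hE : SchurElasticPricingX (1 / 20) (1 / 8) w₄₅ ω₄ (3 / 400) (-(7175 / 10000)) κE CE DE DX (LocOptFails eStar ε ϱ' 1))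
    (hκ0 : 0 < κT) (hκ1 : κT ≤ 1) (h0 : 0 ≤ ρ) (hr : 0 ≤ r) (h1 : 0 ≤ ρ₁) (hρ : ρ ≤ ρ₁ + r) (hR : 9 / 2 ≤ ρ₁ + r)
    (hD : 13 / 10 * D + 1 ≤ ρ₁ + r) (hϱ : ρ + (ρ₁ + r) ≤ ϱ) (hExM : IsLocalFeature ρ₁ (flag ExM))
    (hImp : ∀ (N : ℕ) (y : Fin N → E3), Function.Injective y → Sep y → ∀ j : Fin N, ExM N y j → LocOptFails eStar ε ϱ' 1 N y j)
    (h : EquilibriumMotifPricingCapK κT ρ ϱ D (effPot w₄₅ ω₄ (3 / 400)) (-(7175 / 10000) + 3 / 400) (Collar r ExM)) :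
    Summit.AtomisticToContinuum.Crystallization.Theses.FrustratedLawDichotomy.AperiodicFrustratedLawGap :=
  aperiodicFrustratedLawGap_of_collarMotifCapKK_exM hDoor sf₄₅_holds W₄₅_cutBounds (fun _ hu => effPot_fourHalf_eq_zero _ hu) hU
    (deepAbsent_locOptFails hε) hDX hκE hE hκ0 hκ1 h0 hr h1 hρ hR hD hϱ hExM hImp h

/-- ★ **Periodic sibling at the record range data and the local-optimality exemption.** [folklore chaining] -/
theorem periodicFrustratedLawGap_of_collarMotifCapKK_exM_fourHalf {κT κE ρ r ρ₁ ϱ D ε ϱ' CE DE DX : ℝ} {ExM : SitePred}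
    (hDoor : Summit.AtomisticToContinuum.Crystallization.Theses.GrainCoreNetworkSplit.MuEquilibriumDoor)
    (hU : PeriodicEnergyCeiling (-(7175 / 10000))) (hε : 0 < ε) (hDX : 0 ≤ DX) (hκE : 0 < κE)
    (hE : SchurElasticPricingX (1 / 20) (1 / 8) w₄₅ ω₄ (3 / 400) (-(7175 / 10000)) κE CE DE DX (LocOptFails eStar ε ϱ' 1))
    (hκ0 : 0 < κT) (hκ1 : κT ≤ 1) (h0 : 0 ≤ ρ) (hr : 0 ≤ r) (h1 : 0 ≤ ρ₁) (hρ : ρ ≤ ρ₁ + r) (hR : 9 / 2 ≤ ρ₁ + r)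
    (hD : 13 / 10 * D + 1 ≤ ρ₁ + r) (hϱ : ρ + (ρ₁ + r) ≤ ϱ) (hExM : IsLocalFeature ρ₁ (flag ExM))
    (hImp : ∀ (N : ℕ) (y : Fin N → E3), Function.Injective y → Sep y → ∀ j : Fin N, ExM N y j → LocOptFails eStar ε ϱ' 1 N y j)
    (h : EquilibriumMotifPricingCapK κT ρ ϱ D (effPot w₄₅ ω₄ (3 / 400)) (-(7175 / 10000) + 3 / 400) (Collar r ExM)) :
    Summit.AtomisticToContinuum.Crystallization.Theses.FrustratedLawDichotomy.PeriodicFrustratedLawGap :=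
  periodicFrustratedLawGap_of_collarMotifCapKK_exM hDoor sf₄₅_holds W₄₅_cutBounds (fun _ hu => effPot_fourHalf_eq_zero _ hu) hU
    (deepAbsent_locOptFails hε) hDX hκE hE hκ0 hκ1 h0 hr h1 hρ hR hD hϱ hExM hImp h

/-- Sanity: the κκ-node of record `…Kappa.aperiodicFrustratedLawGap_of_collarMotifCapKK` IS the apex at `ExM := NonEquilibriumCore (−0.7175) ε Rm s t`
(an `example` — the statement is the landed one). [folklore] -/
example {κT κE ρ r ρ₁ ϱ D ε Rm s t ϱ' CE DE DX : ℝ}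
    (hDoor : Summit.AtomisticToContinuum.Crystallization.Theses.GrainCoreNetworkSplit.MuEquilibriumDoor)
    (hU : PeriodicEnergyCeiling (-(7175 / 10000))) (hε : 0 < ε) (hDX : 0 ≤ DX) (hκE : 0 < κE)
    (hE : SchurElasticPricingX (1 / 20) (1 / 8) w₄₅ ω₄ (3 / 400) (-(7175 / 10000)) κE CE DE DX (LocOptFails eStar ε ϱ' 1))
    (hκ0 : 0 < κT) (hκ1 : κT ≤ 1) (h0 : 0 ≤ ρ) (hr : 0 ≤ r) (h1 : 0 ≤ ρ₁) (hρ : ρ ≤ ρ₁ + r) (hR : 9 / 2 ≤ ρ₁ + r)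
    (hD : 13 / 10 * D + 1 ≤ ρ₁ + r) (hRm : Rm ≤ ρ₁) (hϱ : ρ + (ρ₁ + r) ≤ ϱ) (hRm1 : 1 + s ≤ Rm) (hs0 : 0 ≤ s) (hs : s ≤ ϱ') (hεt : ε ≤ t)
    (h : EquilibriumMotifPricingCapK κT ρ ϱ D (effPot w₄₅ ω₄ (3 / 400)) (-(7175 / 10000) + 3 / 400) (CollarCore r (-(7175 / 10000)) ε Rm s t)) :
    Summit.AtomisticToContinuum.Crystallization.Theses.FrustratedLawDichotomy.AperiodicFrustratedLawGap :=
  aperiodicFrustratedLawGap_of_collarMotifCapKK_exM_fourHalf hDoor hU hε hDX hκE hE hκ0 hκ1 h0 hr h1 hρ hR hD hϱ (flag_nonEquilibriumCore_isLocal hRm)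
    (fun _ _ _ hsep _ hx => locOptFails_of_nonEquilibriumCore (eStar_le_of_periodicEnergyCeiling hU) hRm1 hs0 hs hεt hsep hx) h

/-! ## §2. The census object and the three pieces are ANTITONE in the motif exemption -/

/-- `ExemptNear ρ` is monotone in the predicate. [folklore] -/
theorem exemptNear_mono {ρ : ℝ} {ExM ExM' : SitePred} (himp : ∀ (M : ℕ) (z : Fin M → E3) (j : Fin M), ExM M z j → ExM' M z j) {M : ℕ}
    {z : Fin M → E3} {c : Fin M} (hX : ExemptNear ρ ExM z c) : ExemptNear ρ ExM' z c := by
  obtain ⟨j, hj, hxj⟩ := hX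
  exact ⟨j, hj, himp M z j hxj⟩

/-- ★ **The κ-census object is antitone in the exemption**: a LARGER motif-level exempt class gives a WEAKER object. [folklore] -/
theorem equilibriumMotifPricingCapK_anti_exM {κT ρ ϱ D : ℝ} {W : ℝ → ℝ} {e : ℝ} {ExM ExM' : SitePred}
    (himp : ∀ (M : ℕ) (z : Fin M → E3) (j : Fin M), ExM M z j → ExM' M z j) (h : EquilibriumMotifPricingCapK κT ρ ϱ D W e ExM) :
    EquilibriumMotifPricingCapK κT ρ ϱ D W e ExM' :=
  fun M z hz hs c hconf ht hX => h M z hz hs c hconf ht fun hX' => hX (exemptNear_mono himp hX')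

/-- Piece 1 (strained patch) is antitone in the exemption. [folklore] -/
theorem strainedPatchMotifPricingCapXK_anti_exM {κT ρ ϱ D : ℝ} {W : ℝ → ℝ} {e : ℝ} {ExM ExM' : SitePred}
    (himp : ∀ (M : ℕ) (z : Fin M → E3) (j : Fin M), ExM M z j → ExM' M z j) (h : StrainedPatchMotifPricingCapXK κT ρ ϱ D W e ExM) :
    StrainedPatchMotifPricingCapXK κT ρ ϱ D W e ExM' :=
  fun M z hz hs c hconf ht hX hb => h M z hz hs c hconf ht (fun hX' => hX (exemptNear_mono himp hX')) hb

/-- Piece 2 (crowded core) is antitone in the exemption. [folklore] -/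
theorem crowdedCoreMotifPricingCapK_anti_exM {κT ρ ϱ D : ℝ} {W : ℝ → ℝ} {e : ℝ} {ExM ExM' : SitePred}
    (himp : ∀ (M : ℕ) (z : Fin M → E3) (j : Fin M), ExM M z j → ExM' M z j) (h : CrowdedCoreMotifPricingCapK κT ρ ϱ D W e ExM) :
    CrowdedCoreMotifPricingCapK κT ρ ϱ D W e ExM' :=
  fun M z hz hs c hconf ht hX hb hc => h M z hz hs c hconf ht (fun hX' => hX (exemptNear_mono himp hX')) hb hc

/-- Piece 3 (dilute defect) is antitone in the exemption. [folklore] -/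
theorem diluteDefectMotifPricingCapK_anti_exM {κT ρ ϱ D : ℝ} {W : ℝ → ℝ} {e : ℝ} {ExM ExM' : SitePred}
    (himp : ∀ (M : ℕ) (z : Fin M → E3) (j : Fin M), ExM M z j → ExM' M z j) (h : DiluteDefectMotifPricingCapK κT ρ ϱ D W e ExM) :
    DiluteDefectMotifPricingCapK κT ρ ϱ D W e ExM' :=
  fun M z hz hs c hconf ht hX hb hc => h M z hz hs c hconf ht (fun hX' => hX (exemptNear_mono himp hX')) hb hc

/-- The flag of a union `∃ i, P i` of `ρ₁`-local flags is `ρ₁`-local. [folklore] -/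
theorem flag_exists_isLocal {ι : Sort*} {ρ₁ : ℝ} {P : ι → SitePred} (hP : ∀ i, IsLocalFeature ρ₁ (flag (P i))) :
    IsLocalFeature ρ₁ (flag fun N y j => ∃ i, P i N y j) :=
  isLocalFeature_flag_of_iff fun _ _ _ _ hφ _ hS => exists_congr fun i => iff_of_isLocalFeature_flag (hP i) hφ hS

/-! ## §3. The union of the collar exemptions over every step `0 ≤ s ≤ S` -/

/-- ★ **The union-over-steps flag is `ρ₁`-local** (`Rm ≤ ρ₁`): `𝟙[∃ s ∈ [0, S], NonEquilibriumCore eUp ε Rm s t]` is decided on `ρ₁`-motifs. [folklore] -/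
theorem flag_nonEquilibriumCore_union_isLocal {eUp ε Rm t S ρ₁ : ℝ} (hRm : Rm ≤ ρ₁) :
    IsLocalFeature ρ₁ (flag fun N y j => ∃ s : ℝ, 0 ≤ s ∧ s ≤ S ∧ NonEquilibriumCore eUp ε Rm s t N y j) :=
  flag_exists_isLocal (P := fun s N y j => 0 ≤ s ∧ s ≤ S ∧ NonEquilibriumCore eUp ε Rm s t N y j) fun _ =>
    isLocalFeature_flag_of_iff fun _ _ _ _ hφ _ hS =>
      and_congr_right fun _ => and_congr_right fun _ => iff_of_isLocalFeature_flag (flag_nonEquilibriumCore_isLocal hRm) hφ hS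

/-- ★ **The union-over-steps exemption certifies the cluster-level exemption**: `Sep ∧ (∃ s ∈ [0, S], NonEquilibriumCore eUp ε Rm s t) ⟹ ¬LocOpt e⋆ ε ϱ′ 1`
(`e⋆ ≤ eUp`, `1 + S ≤ Rm`, `S ≤ ϱ′`, `ε ≤ t`). [folklore chaining] -/
theorem locOptFails_of_nonEquilibriumCore_union {eUp ε Rm t S ϱ' : ℝ} (hUp : eStar ≤ eUp) (hRm1 : 1 + S ≤ Rm) (hS : S ≤ ϱ') (hεt : ε ≤ t)
    {N : ℕ} {y : Fin N → E3} (hsep : Sep y) {j : Fin N} (h : ∃ s : ℝ, 0 ≤ s ∧ s ≤ S ∧ NonEquilibriumCore eUp ε Rm s t N y j) :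
    LocOptFails eStar ε ϱ' 1 N y j := by
  obtain ⟨s, hs0, hsS, hx⟩ := h
  exact locOptFails_of_nonEquilibriumCore hUp (by linarith) hs0 (hsS.trans hS) hεt hsep hx

/-- A single step is contained in the union (`0 ≤ s ≤ S`). [folklore] -/
theorem nonEquilibriumCore_union_of_step {eUp ε Rm t S s : ℝ} (hs0 : 0 ≤ s) (hsS : s ≤ S) (N : ℕ) (y : Fin N → E3) (j : Fin N)
    (h : NonEquilibriumCore eUp ε Rm s t N y j) : ∃ s' : ℝ, 0 ≤ s' ∧ s' ≤ S ∧ NonEquilibriumCore eUp ε Rm s' t N y j :=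
  ⟨s, hs0, hsS, h⟩

/-- `CollarCore r eUp ε Rm s t ⊆ Collar r ExM∪(S)` for `0 ≤ s ≤ S`. [folklore] -/
theorem collar_union_of_collarCore {r eUp ε Rm t S s : ℝ} (hs0 : 0 ≤ s) (hsS : s ≤ S) (N : ℕ) (y : Fin N → E3) (j : Fin N)
    (h : CollarCore r eUp ε Rm s t N y j) :
    Collar r (fun N y j => ∃ s' : ℝ, 0 ≤ s' ∧ s' ≤ S ∧ NonEquilibriumCore eUp ε Rm s' t N y j) N y j :=
  Collar.mono (nonEquilibriumCore_union_of_step hs0 hsS) h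

/-- ★ The κ-census object at the union exemption is WEAKER than at any single step `s ∈ [0, S]` (any `κ_T ρ ϱ D W e r eUp ε Rm t`). [folklore] -/
theorem equilibriumMotifPricingCapK_union_of_step {κT ρ ϱ D : ℝ} {W : ℝ → ℝ} {e r eUp ε Rm t S s : ℝ} (hs0 : 0 ≤ s) (hsS : s ≤ S)
    (h : EquilibriumMotifPricingCapK κT ρ ϱ D W e (CollarCore r eUp ε Rm s t)) :
    EquilibriumMotifPricingCapK κT ρ ϱ D W e (Collar r fun N y j => ∃ s' : ℝ, 0 ≤ s' ∧ s' ≤ S ∧ NonEquilibriumCore eUp ε Rm s' t N y j) :=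
  equilibriumMotifPricingCapK_anti_exM (collar_union_of_collarCore hs0 hsS) h

/-- ★★ **THE COLLARED NODE AT THE UNION-OVER-STEPS EXEMPTION**, record range data, both levies and the geometry as parameters
(side conditions of `…Kappa.…_of_collarMotifCapKK` with `1 + S ≤ Rm`, `S ≤ ϱ′` in place of the single-step ones):
`MuEquilibriumDoor ∧ UP(−0.7175) ∧ Eopt-raw(κ_E) ∧ EquilibriumMotifPricingCapK κ_T ρ ϱ D W₄₅ e₄₅′ (Collar r ExM∪(S)) ⟹ AperiodicFrustratedLawGap`. [folklore chaining] -/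
theorem aperiodicFrustratedLawGap_of_collarMotifCapKK_union {κT κE ρ r ρ₁ ϱ D ε Rm t S ϱ' CE DE DX : ℝ}
    (hDoor : Summit.AtomisticToContinuum.Crystallization.Theses.GrainCoreNetworkSplit.MuEquilibriumDoor)
    (hU : PeriodicEnergyCeiling (-(7175 / 10000))) (hε : 0 < ε) (hDX : 0 ≤ DX) (hκE : 0 < κE)
    (hE : SchurElasticPricingX (1 / 20) (1 / 8) w₄₅ ω₄ (3 / 400) (-(7175 / 10000)) κE CE DE DX (LocOptFails eStar ε ϱ' 1))
    (hκ0 : 0 < κT) (hκ1 : κT ≤ 1) (h0 : 0 ≤ ρ) (hr : 0 ≤ r) (h1 : 0 ≤ ρ₁) (hρ : ρ ≤ ρ₁ + r) (hR : 9 / 2 ≤ ρ₁ + r)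
    (hD : 13 / 10 * D + 1 ≤ ρ₁ + r) (hRm : Rm ≤ ρ₁) (hϱ : ρ + (ρ₁ + r) ≤ ϱ) (hRm1 : 1 + S ≤ Rm) (hS : S ≤ ϱ') (hεt : ε ≤ t)
    (h : EquilibriumMotifPricingCapK κT ρ ϱ D (effPot w₄₅ ω₄ (3 / 400)) (-(7175 / 10000) + 3 / 400)
      (Collar r fun N y j => ∃ s : ℝ, 0 ≤ s ∧ s ≤ S ∧ NonEquilibriumCore (-(7175 / 10000)) ε Rm s t N y j)) :
    Summit.AtomisticToContinuum.Crystallization.Theses.FrustratedLawDichotomy.AperiodicFrustratedLawGap :=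
  aperiodicFrustratedLawGap_of_collarMotifCapKK_exM_fourHalf hDoor hU hε hDX hκE hE hκ0 hκ1 h0 hr h1 hρ hR hD hϱ
    (flag_nonEquilibriumCore_union_isLocal hRm)
    (fun _ _ _ hsep _ hx => locOptFails_of_nonEquilibriumCore_union (eStar_le_of_periodicEnergyCeiling hU) hRm1 hS hεt hsep hx) h

/-- ★ **Periodic sibling (27624) at the union-over-steps exemption.** [folklore chaining] -/
theorem periodicFrustratedLawGap_of_collarMotifCapKK_union {κT κE ρ r ρ₁ ϱ D ε Rm t S ϱ' CE DE DX : ℝ}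
    (hDoor : Summit.AtomisticToContinuum.Crystallization.Theses.GrainCoreNetworkSplit.MuEquilibriumDoor)
    (hU : PeriodicEnergyCeiling (-(7175 / 10000))) (hε : 0 < ε) (hDX : 0 ≤ DX) (hκE : 0 < κE)
    (hE : SchurElasticPricingX (1 / 20) (1 / 8) w₄₅ ω₄ (3 / 400) (-(7175 / 10000)) κE CE DE DX (LocOptFails eStar ε ϱ' 1))
    (hκ0 : 0 < κT) (hκ1 : κT ≤ 1) (h0 : 0 ≤ ρ) (hr : 0 ≤ r) (h1 : 0 ≤ ρ₁) (hρ : ρ ≤ ρ₁ + r) (hR : 9 / 2 ≤ ρ₁ + r)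
    (hD : 13 / 10 * D + 1 ≤ ρ₁ + r) (hRm : Rm ≤ ρ₁) (hϱ : ρ + (ρ₁ + r) ≤ ϱ) (hRm1 : 1 + S ≤ Rm) (hS : S ≤ ϱ') (hεt : ε ≤ t)
    (h : EquilibriumMotifPricingCapK κT ρ ϱ D (effPot w₄₅ ω₄ (3 / 400)) (-(7175 / 10000) + 3 / 400)
      (Collar r fun N y j => ∃ s : ℝ, 0 ≤ s ∧ s ≤ S ∧ NonEquilibriumCore (-(7175 / 10000)) ε Rm s t N y j)) :
    Summit.AtomisticToContinuum.Crystallization.Theses.FrustratedLawDichotomy.PeriodicFrustratedLawGap :=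
  periodicFrustratedLawGap_of_collarMotifCapKK_exM_fourHalf hDoor hU hε hDX hκE hE hκ0 hκ1 h0 hr h1 hρ hR hD hϱ
    (flag_nonEquilibriumCore_union_isLocal hRm)
    (fun _ _ _ hsep _ hx => locOptFails_of_nonEquilibriumCore_union (eStar_le_of_periodicEnergyCeiling hU) hRm1 hS hεt hsep hx) h

/-- ★ **Every single-step collared node factors through the union node**: the κκ-census object at `CollarCore r (−0.7175) ε Rm s t` for one
`s ∈ [0, S]` gives the crux via `equilibriumMotifPricingCapK_union_of_step` and the union node (same side conditions). [folklore chaining] -/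
theorem aperiodicFrustratedLawGap_of_collarMotifCapKK_step_via_union {κT κE ρ r ρ₁ ϱ D ε Rm t S s ϱ' CE DE DX : ℝ}
    (hDoor : Summit.AtomisticToContinuum.Crystallization.Theses.GrainCoreNetworkSplit.MuEquilibriumDoor)
    (hU : PeriodicEnergyCeiling (-(7175 / 10000))) (hε : 0 < ε) (hDX : 0 ≤ DX) (hκE : 0 < κE)
    (hE : SchurElasticPricingX (1 / 20) (1 / 8) w₄₅ ω₄ (3 / 400) (-(7175 / 10000)) κE CE DE DX (LocOptFails eStar ε ϱ' 1))
    (hκ0 : 0 < κT) (hκ1 : κT ≤ 1) (h0 : 0 ≤ ρ) (hr : 0 ≤ r) (h1 : 0 ≤ ρ₁) (hρ : ρ ≤ ρ₁ + r) (hR : 9 / 2 ≤ ρ₁ + r)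
    (hD : 13 / 10 * D + 1 ≤ ρ₁ + r) (hRm : Rm ≤ ρ₁) (hϱ : ρ + (ρ₁ + r) ≤ ϱ) (hRm1 : 1 + S ≤ Rm) (hS : S ≤ ϱ') (hεt : ε ≤ t)
    (hs0 : 0 ≤ s) (hsS : s ≤ S)
    (h : EquilibriumMotifPricingCapK κT ρ ϱ D (effPot w₄₅ ω₄ (3 / 400)) (-(7175 / 10000) + 3 / 400) (CollarCore r (-(7175 / 10000)) ε Rm s t)) :
    Summit.AtomisticToContinuum.Crystallization.Theses.FrustratedLawDichotomy.AperiodicFrustratedLawGap :=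
  aperiodicFrustratedLawGap_of_collarMotifCapKK_union hDoor hU hε hDX hκE hE hκ0 hκ1 h0 hr h1 hρ hR hD hRm hϱ hRm1 hS hεt
    (equilibriumMotifPricingCapK_union_of_step hs0 hsS h)

/-! ## §4. The union leaf line at the literals of record, its door-free form, and the transfers from every single step -/

/-- ★★★ **THE UNION LEAF LINE** (levies of record `κ_T = 1/1000`, `κ_E = 1/10000`; record geometry `(ρ, D, r, ρ₁, ϱ, ε, Rm, t, ϱ′) =
(9/5, 3/2, 9/2, 7, 133/10, 10⁻⁴, 7, 10⁻⁴, 3/2)`; exemption `ExM∪ = Collar (9/2) (∃ s ∈ [0, 3/2], NonEquilibriumCore (−0.7175) 10⁻⁴ 7 s 10⁻⁴)` — EVERY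
admissible step at once): `MuEquilibriumDoor ∧ UP(−0.7175) ∧ Eopt-raw(1/10000) ∧ F1^X∪ ∧ CC∪ ∧ DD∪ ⟹ AperiodicFrustratedLawGap`. [folklore instantiation] -/
theorem aperiodicFrustratedLawGap_of_collarPiecesKK_milli_union {CE DE DX : ℝ}
    (hDoor : Summit.AtomisticToContinuum.Crystallization.Theses.GrainCoreNetworkSplit.MuEquilibriumDoor)
    (hU : PeriodicEnergyCeiling (-(7175 / 10000))) (hDX : 0 ≤ DX)
    (hE : SchurElasticPricingX (1 / 20) (1 / 8) w₄₅ ω₄ (3 / 400) (-(7175 / 10000)) (1 / 10000) CE DE DX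
      (LocOptFails eStar (1 / 10000) (3 / 2) 1))
    (h1 : StrainedPatchMotifPricingCapXK (1 / 1000) (9 / 5) (133 / 10) (3 / 2) (effPot w₄₅ ω₄ (3 / 400)) (-(7175 / 10000) + 3 / 400)
      (Collar (9 / 2) fun N y j => ∃ s : ℝ, 0 ≤ s ∧ s ≤ 3 / 2 ∧ NonEquilibriumCore (-(7175 / 10000)) (1 / 10000) 7 s (1 / 10000) N y j))
    (h2 : CrowdedCoreMotifPricingCapK (1 / 1000) (9 / 5) (133 / 10) (3 / 2) (effPot w₄₅ ω₄ (3 / 400)) (-(7175 / 10000) + 3 / 400)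
      (Collar (9 / 2) fun N y j => ∃ s : ℝ, 0 ≤ s ∧ s ≤ 3 / 2 ∧ NonEquilibriumCore (-(7175 / 10000)) (1 / 10000) 7 s (1 / 10000) N y j))
    (h3 : DiluteDefectMotifPricingCapK (1 / 1000) (9 / 5) (133 / 10) (3 / 2) (effPot w₄₅ ω₄ (3 / 400)) (-(7175 / 10000) + 3 / 400)
      (Collar (9 / 2) fun N y j => ∃ s : ℝ, 0 ≤ s ∧ s ≤ 3 / 2 ∧ NonEquilibriumCore (-(7175 / 10000)) (1 / 10000) 7 s (1 / 10000) N y j)) :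
    Summit.AtomisticToContinuum.Crystallization.Theses.FrustratedLawDichotomy.AperiodicFrustratedLawGap :=
  aperiodicFrustratedLawGap_of_collarMotifCapKK_union (ρ₁ := 7) hDoor hU (by norm_num) hDX (by norm_num) hE (by norm_num) (by norm_num) (by norm_num)
    (by norm_num) (by norm_num) (by norm_num) (by norm_num) (by norm_num) le_rfl (by norm_num) (by norm_num) le_rfl le_rfl
    (equilibriumMotifPricingCapK_iff_pieces.2 ⟨h1, h2, h3⟩)

/-- ★★ **The periodic sibling (27624), union leaf line.** [folklore instantiation] -/
theorem periodicFrustratedLawGap_of_collarPiecesKK_milli_union {CE DE DX : ℝ}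
    (hDoor : Summit.AtomisticToContinuum.Crystallization.Theses.GrainCoreNetworkSplit.MuEquilibriumDoor)
    (hU : PeriodicEnergyCeiling (-(7175 / 10000))) (hDX : 0 ≤ DX)
    (hE : SchurElasticPricingX (1 / 20) (1 / 8) w₄₅ ω₄ (3 / 400) (-(7175 / 10000)) (1 / 10000) CE DE DX
      (LocOptFails eStar (1 / 10000) (3 / 2) 1))
    (h1 : StrainedPatchMotifPricingCapXK (1 / 1000) (9 / 5) (133 / 10) (3 / 2) (effPot w₄₅ ω₄ (3 / 400)) (-(7175 / 10000) + 3 / 400)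
      (Collar (9 / 2) fun N y j => ∃ s : ℝ, 0 ≤ s ∧ s ≤ 3 / 2 ∧ NonEquilibriumCore (-(7175 / 10000)) (1 / 10000) 7 s (1 / 10000) N y j))
    (h2 : CrowdedCoreMotifPricingCapK (1 / 1000) (9 / 5) (133 / 10) (3 / 2) (effPot w₄₅ ω₄ (3 / 400)) (-(7175 / 10000) + 3 / 400)
      (Collar (9 / 2) fun N y j => ∃ s : ℝ, 0 ≤ s ∧ s ≤ 3 / 2 ∧ NonEquilibriumCore (-(7175 / 10000)) (1 / 10000) 7 s (1 / 10000) N y j))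
    (h3 : DiluteDefectMotifPricingCapK (1 / 1000) (9 / 5) (133 / 10) (3 / 2) (effPot w₄₅ ω₄ (3 / 400)) (-(7175 / 10000) + 3 / 400)
      (Collar (9 / 2) fun N y j => ∃ s : ℝ, 0 ≤ s ∧ s ≤ 3 / 2 ∧ NonEquilibriumCore (-(7175 / 10000)) (1 / 10000) 7 s (1 / 10000) N y j)) :
    Summit.AtomisticToContinuum.Crystallization.Theses.FrustratedLawDichotomy.PeriodicFrustratedLawGap :=
  periodicFrustratedLawGap_of_collarMotifCapKK_union (ρ₁ := 7) hDoor hU (by norm_num) hDX (by norm_num) hE (by norm_num) (by norm_num) (by norm_num)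
    (by norm_num) (by norm_num) (by norm_num) (by norm_num) (by norm_num) le_rfl (by norm_num) (by norm_num) le_rfl le_rfl
    (equilibriumMotifPricingCapK_iff_pieces.2 ⟨h1, h2, h3⟩)

/-- ★★★ **THE UNION LEAF LINE, DOOR-FREE** (`MuEquilibriumDoor` discharged by `muEquilibriumDoor`; `hU` kept — its discharge is computational):
`UP(−0.7175) ∧ 0 ≤ D_X ∧ Eopt-raw(1/10000) ∧ F1^X∪ ∧ CC∪ ∧ DD∪ ⟹ AperiodicFrustratedLawGap`. [folklore instantiation] -/
theorem aperiodicFrustratedLawGap_of_collarPiecesKK_milli_union_doorFree {CE DE DX : ℝ}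
    (hU : PeriodicEnergyCeiling (-(7175 / 10000))) (hDX : 0 ≤ DX)
    (hE : SchurElasticPricingX (1 / 20) (1 / 8) w₄₅ ω₄ (3 / 400) (-(7175 / 10000)) (1 / 10000) CE DE DX
      (LocOptFails eStar (1 / 10000) (3 / 2) 1))
    (h1 : StrainedPatchMotifPricingCapXK (1 / 1000) (9 / 5) (133 / 10) (3 / 2) (effPot w₄₅ ω₄ (3 / 400)) (-(7175 / 10000) + 3 / 400)
      (Collar (9 / 2) fun N y j => ∃ s : ℝ, 0 ≤ s ∧ s ≤ 3 / 2 ∧ NonEquilibriumCore (-(7175 / 10000)) (1 / 10000) 7 s (1 / 10000) N y j))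
    (h2 : CrowdedCoreMotifPricingCapK (1 / 1000) (9 / 5) (133 / 10) (3 / 2) (effPot w₄₅ ω₄ (3 / 400)) (-(7175 / 10000) + 3 / 400)
      (Collar (9 / 2) fun N y j => ∃ s : ℝ, 0 ≤ s ∧ s ≤ 3 / 2 ∧ NonEquilibriumCore (-(7175 / 10000)) (1 / 10000) 7 s (1 / 10000) N y j))
    (h3 : DiluteDefectMotifPricingCapK (1 / 1000) (9 / 5) (133 / 10) (3 / 2) (effPot w₄₅ ω₄ (3 / 400)) (-(7175 / 10000) + 3 / 400)
      (Collar (9 / 2) fun N y j => ∃ s : ℝ, 0 ≤ s ∧ s ≤ 3 / 2 ∧ NonEquilibriumCore (-(7175 / 10000)) (1 / 10000) 7 s (1 / 10000) N y j)) :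
    Summit.AtomisticToContinuum.Crystallization.Theses.FrustratedLawDichotomy.AperiodicFrustratedLawGap :=
  aperiodicFrustratedLawGap_of_collarPiecesKK_milli_union muEquilibriumDoor hU hDX hE h1 h2 h3

/-- ★★ **Periodic sibling (27624), union leaf line, door-free.** [folklore instantiation] -/
theorem periodicFrustratedLawGap_of_collarPiecesKK_milli_union_doorFree {CE DE DX : ℝ}
    (hU : PeriodicEnergyCeiling (-(7175 / 10000))) (hDX : 0 ≤ DX)
    (hE : SchurElasticPricingX (1 / 20) (1 / 8) w₄₅ ω₄ (3 / 400) (-(7175 / 10000)) (1 / 10000) CE DE DX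
      (LocOptFails eStar (1 / 10000) (3 / 2) 1))
    (h1 : StrainedPatchMotifPricingCapXK (1 / 1000) (9 / 5) (133 / 10) (3 / 2) (effPot w₄₅ ω₄ (3 / 400)) (-(7175 / 10000) + 3 / 400)
      (Collar (9 / 2) fun N y j => ∃ s : ℝ, 0 ≤ s ∧ s ≤ 3 / 2 ∧ NonEquilibriumCore (-(7175 / 10000)) (1 / 10000) 7 s (1 / 10000) N y j))
    (h2 : CrowdedCoreMotifPricingCapK (1 / 1000) (9 / 5) (133 / 10) (3 / 2) (effPot w₄₅ ω₄ (3 / 400)) (-(7175 / 10000) + 3 / 400)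
      (Collar (9 / 2) fun N y j => ∃ s : ℝ, 0 ≤ s ∧ s ≤ 3 / 2 ∧ NonEquilibriumCore (-(7175 / 10000)) (1 / 10000) 7 s (1 / 10000) N y j))
    (h3 : DiluteDefectMotifPricingCapK (1 / 1000) (9 / 5) (133 / 10) (3 / 2) (effPot w₄₅ ω₄ (3 / 400)) (-(7175 / 10000) + 3 / 400)
      (Collar (9 / 2) fun N y j => ∃ s : ℝ, 0 ≤ s ∧ s ≤ 3 / 2 ∧ NonEquilibriumCore (-(7175 / 10000)) (1 / 10000) 7 s (1 / 10000) N y j)) :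
    Summit.AtomisticToContinuum.Crystallization.Theses.FrustratedLawDichotomy.PeriodicFrustratedLawGap :=
  periodicFrustratedLawGap_of_collarPiecesKK_milli_union muEquilibriumDoor hU hDX hE h1 h2 h3

/-- ★★ **TRANSFER FROM EVERY SINGLE STEP**: the three pieces at `CollarCore (9/2) (−0.7175) 10⁻⁴ 7 s 10⁻⁴` for ANY `s ∈ [0, 3/2]` (levy `κ_T`, any
`ρ ϱ D`) imply the three pieces at the union exemption — so the milli (`s = 1/20`) AND the quiet (`s_q = 1/200`) certificates both feed the union line.
[folklore] -/
theorem collarPiecesKK_union_of_step {κT ρ ϱ D s : ℝ} (hs0 : 0 ≤ s) (hs1 : s ≤ 3 / 2)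
    (h1 : StrainedPatchMotifPricingCapXK κT ρ ϱ D (effPot w₄₅ ω₄ (3 / 400)) (-(7175 / 10000) + 3 / 400)
      (CollarCore (9 / 2) (-(7175 / 10000)) (1 / 10000) 7 s (1 / 10000)))
    (h2 : CrowdedCoreMotifPricingCapK κT ρ ϱ D (effPot w₄₅ ω₄ (3 / 400)) (-(7175 / 10000) + 3 / 400)
      (CollarCore (9 / 2) (-(7175 / 10000)) (1 / 10000) 7 s (1 / 10000)))
    (h3 : DiluteDefectMotifPricingCapK κT ρ ϱ D (effPot w₄₅ ω₄ (3 / 400)) (-(7175 / 10000) + 3 / 400)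
      (CollarCore (9 / 2) (-(7175 / 10000)) (1 / 10000) 7 s (1 / 10000))) :
    StrainedPatchMotifPricingCapXK κT ρ ϱ D (effPot w₄₅ ω₄ (3 / 400)) (-(7175 / 10000) + 3 / 400)
        (Collar (9 / 2) fun N y j => ∃ s' : ℝ, 0 ≤ s' ∧ s' ≤ 3 / 2 ∧ NonEquilibriumCore (-(7175 / 10000)) (1 / 10000) 7 s' (1 / 10000) N y j) ∧
      CrowdedCoreMotifPricingCapK κT ρ ϱ D (effPot w₄₅ ω₄ (3 / 400)) (-(7175 / 10000) + 3 / 400)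
        (Collar (9 / 2) fun N y j => ∃ s' : ℝ, 0 ≤ s' ∧ s' ≤ 3 / 2 ∧ NonEquilibriumCore (-(7175 / 10000)) (1 / 10000) 7 s' (1 / 10000) N y j) ∧
      DiluteDefectMotifPricingCapK κT ρ ϱ D (effPot w₄₅ ω₄ (3 / 400)) (-(7175 / 10000) + 3 / 400)
        (Collar (9 / 2) fun N y j => ∃ s' : ℝ, 0 ≤ s' ∧ s' ≤ 3 / 2 ∧ NonEquilibriumCore (-(7175 / 10000)) (1 / 10000) 7 s' (1 / 10000) N y j) :=
  ⟨strainedPatchMotifPricingCapXK_anti_exM (collar_union_of_collarCore hs0 hs1) h1,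
    crowdedCoreMotifPricingCapK_anti_exM (collar_union_of_collarCore hs0 hs1) h2,
    diluteDefectMotifPricingCapK_anti_exM (collar_union_of_collarCore hs0 hs1) h3⟩

/-- ★ Sanity: **the union line is implied by the QUIET line of record's pieces** (`s_q = 1/200`; same levies) — the union leaf is WEAKER than
`…CollarCensusQuiet.aperiodicFrustratedLawGap_of_collarPiecesKK_milli_quiet`'s T-side inputs (an `example`: the statement is literally the landed
`…MilliDoorFree.…_milli_quiet_doorFree`, dedup). [folklore] -/
example {CE DE DX : ℝ}
    (hU : PeriodicEnergyCeiling (-(7175 / 10000))) (hDX : 0 ≤ DX)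
    (hE : SchurElasticPricingX (1 / 20) (1 / 8) w₄₅ ω₄ (3 / 400) (-(7175 / 10000)) (1 / 10000) CE DE DX
      (LocOptFails eStar (1 / 10000) (3 / 2) 1))
    (h1 : StrainedPatchMotifPricingCapXK (1 / 1000) (9 / 5) (133 / 10) (3 / 2) (effPot w₄₅ ω₄ (3 / 400)) (-(7175 / 10000) + 3 / 400)
      (CollarCore (9 / 2) (-(7175 / 10000)) (1 / 10000) 7 (1 / 200) (1 / 10000)))
    (h2 : CrowdedCoreMotifPricingCapK (1 / 1000) (9 / 5) (133 / 10) (3 / 2) (effPot w₄₅ ω₄ (3 / 400)) (-(7175 / 10000) + 3 / 400)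
      (CollarCore (9 / 2) (-(7175 / 10000)) (1 / 10000) 7 (1 / 200) (1 / 10000)))
    (h3 : DiluteDefectMotifPricingCapK (1 / 1000) (9 / 5) (133 / 10) (3 / 2) (effPot w₄₅ ω₄ (3 / 400)) (-(7175 / 10000) + 3 / 400)
      (CollarCore (9 / 2) (-(7175 / 10000)) (1 / 10000) 7 (1 / 200) (1 / 10000))) :
    Summit.AtomisticToContinuum.Crystallization.Theses.FrustratedLawDichotomy.AperiodicFrustratedLawGap :=
  have h := collarPiecesKK_union_of_step (by norm_num) (by norm_num) h1 h2 h3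
  aperiodicFrustratedLawGap_of_collarPiecesKK_milli_union_doorFree hU hDX hE h.1 h.2.1 h.2.2

end Summit.AtomisticToContinuum.Crystallization.Theorems.FrustratedLawDichotomyCollarCensusUnion

end
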